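import Summits.RiemannHypothesis.RiemannHypothesis.Theses.JensenLogBand
import Summits.RiemannHypothesis.RiemannHypothesis.Theorems.JensenPolynomialsLogBandArith

/-!
# Route `JensenLogBand` (rung J-P (P3), terminal RH-free rung of the Jensen column) — support item `LogBandArith` PROVED

`LogBandArith` (theory g9's registered text: `∀ c c', 0 < c' → c' < c → ∃ n₂, ∀ d n, n₂ ≤ n → d + 1 ≤ e^{c'n} →
2d + (1+√n)√(2d) ≤ e^{cn}`) is the tree lemma `LogBand.logBandArith` (p473471, `Theorems/JensenPolynomialsLogBandArith.lean`;
the hypothesis `0 < c'` is not needed). RH-FREE pure real arithmetic. WHAT THIS IS NOT: nothing here bears on zeros of `ζ` or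
the truth of RH.
-/

noncomputable section
-- D-0017: `Summit.RiemannHypothesis.RiemannHypothesis.…` duplicates the namespace BY DESIGN (single-problem summit).
set_option linter.dupNamespace false

namespace Summit.RiemannHypothesis.RiemannHypothesis.Theorems.JensenPolynomials.LogBand

/-- **Support item `LogBandArith` of route «JensenLogBand» (RH-FREE), PROVED:** the registered statement, by the tree lemma `LogBand.logBandArith` (p473471; theory g9 pre-birth check logband/bc/check_logBandArith.lean rc 0). -/
theorem logBandArith_holds : Summit.RiemannHypothesis.RiemannHypothesis.Theses.JensenLogBand.LogBandArith := by
  unfold Summit.RiemannHypothesis.RiemannHypothesis.Theses.JensenLogBand.LogBandArith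
  intro c c' _ hcc
  exact logBandArith c c' hcc

end Summit.RiemannHypothesis.RiemannHypothesis.Theorems.JensenPolynomials.LogBand

end
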